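import Mathlib

/-!
# Tier4/Line3/Witness/LatticeGauss — Gaussian sums over lattices and over the integers of a number field
(seat t4-L2-p2, gen 0, for the `summable` clause of the R4 witness of LINE L3's `ThetaData`, t4-plan-3 S12460;
blind re-derivation cell `pub-hodge-repro`, Tier 4, README §9–§10)

* `summable_exp_neg_mul_norm_sq`: for a `ℤ`-lattice `L` in a finite-dimensional real normed space and `c > 0`,
  `∑_{v ∈ L} exp (−c ‖v‖²) < ∞` — `exp (−c r²) ≤ (m!/c^m) r^{−2m}` with `2m > rank L` (`Real.pow_div_factorial_le_exp`)
  and Mathlib's `ZLattice.summable_norm_rpow`;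
* `summable_exp_neg_sum_sq`: for a number field `K` and a finite set `S` of complex embeddings meeting every conjugate
  pair, `∑_{a ∈ 𝓞_K} exp (−c Σ_{σ ∈ S} ‖σ a‖²) < ∞` — the sup norm of the mixed embedding is `max_w w(a)`, each `w(a)`
  is some `‖σ a‖` with `σ ∈ S`, so `‖ι a‖² ≤ Σ_{σ ∈ S} ‖σ a‖²` (`norm_mixedEmbedding_sq_le`), and `a ↦ ι a` injects
  `𝓞_K` into Mathlib's `mixedEmbedding.integerLattice K`.

Mathlib only.  Nothing here says anything about the status of the Hodge conjecture for CM abelian varieties, which is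
NOT proved (HC_CM is NOT proved by anyone in this repository).
-/

set_option autoImplicit false

noncomputable section

open NumberField
open scoped Classical

namespace Summit.Ventures.HodgeRepro.Tier4.Line3

/-- `exp (−c r²) ≤ (m! / c^m) · r^{−2m}` for `r > 0`, `c > 0`. -/
theorem exp_neg_mul_sq_le (c : ℝ) (hc : 0 < c) (m : ℕ) {r : ℝ} (hr : 0 < r) :
    Real.exp (-(c * r ^ 2)) ≤ (m.factorial / c ^ m) * r ^ (-(2 * m : ℝ)) := by
  have h1 := Real.pow_div_factorial_le_exp (c * r ^ 2) (by positivity) m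
  have hfac : (0 : ℝ) < m.factorial := by exact_mod_cast Nat.factorial_pos m
  have hpow : 0 < (c * r ^ 2) ^ m := by positivity
  rw [Real.exp_neg, Real.rpow_neg hr.le, show ((2 * m : ℝ)) = ((2 * m : ℕ) : ℝ) by push_cast; ring,
    Real.rpow_natCast, pow_mul]
  calc (Real.exp (c * r ^ 2))⁻¹ ≤ ((c * r ^ 2) ^ m / m.factorial)⁻¹ := inv_anti₀ (by positivity) h1
    _ = m.factorial / c ^ m * ((r ^ 2) ^ m)⁻¹ := by
        rw [inv_div, mul_pow]
        field_simp

/-- **Gaussian sums over a lattice converge**: for a `ℤ`-lattice `L` in a finite-dimensional real normed space and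
`c > 0`, `∑_{v ∈ L} exp (−c ‖v‖²)` converges (`exp (−c r²) ≤ C r^{−2m}` with `2m > rank L`, and
`ZLattice.summable_norm_rpow`). -/
theorem summable_exp_neg_mul_norm_sq {E : Type*} [NormedAddCommGroup E] [NormedSpace ℝ E] [FiniteDimensional ℝ E]
    (L : Submodule ℤ E) [DiscreteTopology L] {c : ℝ} (hc : 0 < c) :
    Summable fun v : L => Real.exp (-(c * ‖(v : E)‖ ^ 2)) := by
  classical
  set m : ℕ := Module.finrank ℤ L + 1 with hm
  have hr : (-(2 * m : ℝ)) < -(Module.finrank ℤ L : ℝ) := by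
    rw [hm]; push_cast; linarith [(Nat.cast_nonneg (Module.finrank ℤ L) : (0 : ℝ) ≤ _)]
  have hsum := ZLattice.summable_norm_rpow L (-(2 * m : ℝ)) hr
  have hind : Summable (fun v : L => if v = 0 then (1 : ℝ) else 0) := by
    refine summable_of_hasFiniteSupport ?_
    refine (Set.finite_singleton (0 : L)).subset ?_
    intro v hv
    simp only [Function.mem_support, ne_eq] at hv
    by_contra h
    exact hv (if_neg h)
  refine Summable.of_nonneg_of_le (fun v => (Real.exp_pos _).le) (fun v => ?_)
    ((hsum.mul_left (m.factorial / c ^ m)).add hind)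
  by_cases hv : v = 0
  · subst hv
    have h2m : (-(2 * m : ℝ)) ≠ 0 := by
      have : (0 : ℝ) < m := by rw [hm]; positivity
      linarith
    simp [Real.zero_rpow h2m]
  · have hv' : (v : E) ≠ 0 := fun h => hv (Subtype.ext h)
    have hr0 : 0 < ‖(v : E)‖ := norm_pos_iff.mpr hv'
    simp only [hv, if_false, add_zero]
    exact exp_neg_mul_sq_le c hc m hr0

/-! ### The integers of a number field: Gaussian sums over `𝓞_K` in the embedding coordinates -/

variable (K : Type*) [Field K] [NumberField K]

/-- The image of an integer in the mixed space, as an element of the integer lattice. -/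
def toLattice (a : 𝓞 K) : mixedEmbedding.integerLattice K :=
  ⟨mixedEmbedding K (algebraMap (𝓞 K) K a), LinearMap.mem_range.mpr ⟨a, rfl⟩⟩

/-- `𝓞_K → integerLattice K` is injective. -/
theorem toLattice_injective : Function.Injective (toLattice K) := by
  intro a b hab
  have := congrArg Subtype.val hab
  exact RingOfIntegers.coe_injective (mixedEmbedding_injective K this)

omit [NumberField K] in
/-- For every infinite place `w` and a set `S` of complex embeddings meeting every conjugate pair, `w a = ‖σ a‖`
for some `σ ∈ S`. -/
theorem exists_mem_eq_apply (S : Finset (K →+* ℂ)) (hS : ∀ φ : K →+* ℂ, φ ∈ S ∨ ComplexEmbedding.conjugate φ ∈ S)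
    (w : InfinitePlace K) (a : K) : ∃ σ ∈ S, w a = ‖σ a‖ := by
  rcases hS w.embedding with h | h
  · exact ⟨w.embedding, h, (InfinitePlace.norm_embedding_eq w a).symm⟩
  · refine ⟨_, h, ?_⟩
    rw [ComplexEmbedding.conjugate_coe_eq, Complex.norm_conj, InfinitePlace.norm_embedding_eq]

/-- `‖ι a‖² ≤ Σ_{σ ∈ S} ‖σ a‖²` for the mixed-space (sup) norm, `S` meeting every conjugate pair. -/
theorem norm_mixedEmbedding_sq_le (S : Finset (K →+* ℂ))
    (hS : ∀ φ : K →+* ℂ, φ ∈ S ∨ ComplexEmbedding.conjugate φ ∈ S) (a : K) :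
    ‖mixedEmbedding K a‖ ^ 2 ≤ ∑ σ ∈ S, ‖σ a‖ ^ 2 := by
  rw [mixedEmbedding.norm_eq_sup'_normAtPlace]
  obtain ⟨w, -, hw⟩ := Finset.exists_mem_eq_sup' Finset.univ_nonempty
    (fun w : InfinitePlace K => mixedEmbedding.normAtPlace w (mixedEmbedding K a))
  rw [hw, mixedEmbedding.normAtPlace_apply]
  obtain ⟨σ, hσ, hσa⟩ := exists_mem_eq_apply K S hS w a
  rw [hσa]
  exact Finset.single_le_sum (fun τ _ => sq_nonneg ‖τ a‖) hσ

/-- **Gaussian sums over `𝓞_K` converge** in the coordinates of a set `S` of embeddings meeting every conjugate pair: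
`∑_{a ∈ 𝓞_K} exp (−c Σ_{σ ∈ S} ‖σ a‖²) < ∞`. -/
theorem summable_exp_neg_sum_sq (S : Finset (K →+* ℂ))
    (hS : ∀ φ : K →+* ℂ, φ ∈ S ∨ ComplexEmbedding.conjugate φ ∈ S) {c : ℝ} (hc : 0 < c) :
    Summable fun a : 𝓞 K => Real.exp (-(c * ∑ σ ∈ S, ‖σ (algebraMap (𝓞 K) K a)‖ ^ 2)) := by
  have h := (summable_exp_neg_mul_norm_sq (mixedEmbedding.integerLattice K) hc).comp_injective
    (toLattice_injective K)
  refine Summable.of_nonneg_of_le (fun a => (Real.exp_pos _).le) (fun a => ?_) h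
  simp only [Function.comp_apply, toLattice]
  rw [Real.exp_le_exp, neg_le_neg_iff]
  gcongr
  exact norm_mixedEmbedding_sq_le K S hS _

end Summit.Ventures.HodgeRepro.Tier4.Line3
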